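import Mathlib
import Literature.Geometry.Lorentzian.WeylScalarPhaseWindow

/-!
# A spatio-temporal symmetry of order `m` factorises the monodromy: `M = K ^ m`

HONEST FRAMING (cell `ns-blowup`, seat `ns-blowup-instab`, human ruling D-0035): nothing here is a
claim about Navier–Stokes blow-up. WHAT THIS IS NOT: not NS evidence for (T)/(A); it is the monoid
algebra and the elementary complex/real arithmetic behind the IDENTITY RIDER of the cell's X1″
iteration P-X1″-B (refuter RESULT ENGINE-2′F part 1, 2026-08-25 14:50Z; planner RECORD 14:40Z (2)),
typed so that the tree's `FloquetCubeRootClass` (which takes `M = K ^ 3` as HYPOTHESIS `hM`) has its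
hypothesis DERIVED from first principles.

Dictionary. `Φ t s` is the propagator of a linear (or any) evolution from time `s` to time `t`
(for the cell: Navier–Stokes linearised about the breathing Beltrami-shell host
`U_t = abc(1 + δ cos(Ω t + 2πj/3))_{j=0,1,2}`), an element of a monoid `G` (endomorphisms under
composition). The COCYCLE law `Φ t u * Φ u r = Φ t r` is assumed only for ordered times
`r ≤ u ≤ t` (semiflows are allowed), with `Φ s s = 1`. The host's SPATIO-TEMPORAL SYMMETRY
`U(t + τ) = P · U(t)` (`P` = cyclic permutation of the axes, `τ = T/3`, `P ^ 3 = 1`) makes the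
linearised operator, hence the propagator, EQUIVARIANT: `Φ (t + τ) (s + τ) = P * Φ t s * P⁻¹`.

* (F1) `propagator_add_nat_mul` — `Φ (s + k τ) s = P ^ k * (P⁻¹ * Φ (s + τ) s) ^ k` for every `k`;
  with `P ^ m = 1` (`monodromy_eq_pow`): the phase-`s` MONODROMY over the period `T = m τ` is an
  exact `m`-th power, `M_s = K_s ^ m`, `K_s = P⁻¹ * Φ (s + τ) s` (`m = 3`: `monodromy_eq_cube`,
  the refuter's `M₀ = K³`; `m = 2`: the half-period rule for hosts with a symmetric wobble).
  If `G` is an algebra of REAL operators and `P` is real, `K_s` is real — locking is decided by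
  the spectrum of the real operator `K_s`, not by the phases of the multipliers of `M_s`.
* (F2) `monodromy_phase_shift` — `M_{s+τ} = P * M_s * P⁻¹` (readouts at `P`-cycled anchors
  coincide after the shift by `τ`); `propagator_periodic` — `Φ` is `T`-periodic in both arguments;
  `monodromy_intertwine` — `M_s * Φ s 0 = Φ s 0 * M_0` (all phases carry the same multipliers).
* (F3) LOCKING RULE (`m = 3`), as polynomial identities on `(Re κ, Im κ)` so that no branch of
  `arg` is needed (component formulas reused from `Literature…WeylPhase.im_cube/re_cube`); a NON-REAL `κ` has a real cube iff
  `Im²κ = 3 Re²κ` (directions `±π/3, ±2π/3`), and then `κ³ = −8 Re³κ` — the directions `±π/3`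
  (`Re κ > 0`) lock onto the NEGATIVE real axis of `M` («R−» modes), the directions `±2π/3`
  (`Re κ < 0`) onto the POSITIVE axis («R+»); `cube_real_pos_iff` is the complete statement.
* (F4) DOUBLET DETERMINANT RULE: on a real invariant 2-plane the block of `K` has trace `t` and
  determinant `d` and its eigenvalues are the roots of `z² − t z + d` (`charpoly root`:
  `quadratic_of_eigen_fin_two`, from the 2×2 Cayley–Hamilton identity `cayley_hamilton_fin_two`).
  A non-real root has `|z|² = d` (`normSq_eq_of_nonreal_root`); two distinct real roots have
  product `d` (`vieta_of_real_roots`). Hence across a collision AT FIXED `d` the exponents obey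
  `log|κ₊| + log|κ₋| = log d = 2 log|κ_pair|` (`log_sum_eq_of_real_roots`,
  `two_log_norm_eq_of_nonreal_root`) — the «γ₊ + γ₋ ≈ 2 γ_parent» bookkeeping is EXACT at the
  collision parameter and approximate nearby only through the variation of `d`.

Mathlib only; no new definitions. References: the cell files `STATUS.md` ll.463/467,
`instab/P-X1pp-B-PREREG-CONFORMED.md` §C4; G. Floquet (1883); for spatio-temporal symmetries of
periodic orbits see e.g. J. S. W. Lamb & I. Melbourne, *Arch. Ration. Mech. Anal.* 149 (1999) 229–270
(the `k`-th root structure of the monodromy is standard there; typed here from scratch).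
-/

namespace Summit.NavierStokesRegularity.FluidComputer.SpatioTemporalMonodromyFactorisation

/-! ## (F1)–(F2) Propagator cocycle + equivariance under a unit of finite order -/

section Propagator

variable {G : Type*} [Monoid G]

/-- Iterated equivariance: if `Φ (t + τ) (s + τ) = P Φ(t,s) P⁻¹` for all `t, s`, then
`Φ (t + kτ) (s + kτ) = P^k Φ(t,s) P^{-k}` for every natural `k`. -/
theorem equivariance_iterate (Φ : ℝ → ℝ → G) (P : Gˣ) (τ : ℝ)
    (hequi : ∀ t s : ℝ, Φ (t + τ) (s + τ) = ↑P * Φ t s * ↑P⁻¹) (k : ℕ) (t s : ℝ) :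
    Φ (t + k * τ) (s + k * τ) = ↑(P ^ k) * Φ t s * ↑(P ^ k)⁻¹ := by
  induction k with
  | zero => simp
  | succ k ih =>
    have h1 : t + ((k + 1 : ℕ) : ℝ) * τ = (t + k * τ) + τ := by push_cast; ring
    have h2 : s + ((k + 1 : ℕ) : ℝ) * τ = (s + k * τ) + τ := by push_cast; ring
    rw [h1, h2, hequi, ih, pow_succ']
    simp only [mul_inv_rev, Units.val_mul, mul_assoc]

/-- **(F1) The propagator over `k` symmetry-steps is `P^k` times a `k`-th power.**
Cocycle (for ordered times) + `Φ s s = 1` + equivariance under the unit `P` with time shift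
`τ ≥ 0` give `Φ (s + kτ) s = P^k (P⁻¹ Φ(s+τ, s))^k`. -/
theorem propagator_add_nat_mul (Φ : ℝ → ℝ → G) (P : Gˣ) {τ : ℝ} (hτ : 0 ≤ τ)
    (hid : ∀ s : ℝ, Φ s s = 1)
    (hcoc : ∀ r u t : ℝ, r ≤ u → u ≤ t → Φ t u * Φ u r = Φ t r)
    (hequi : ∀ t s : ℝ, Φ (t + τ) (s + τ) = ↑P * Φ t s * ↑P⁻¹) (k : ℕ) (s : ℝ) :
    Φ (s + k * τ) s = ↑(P ^ k) * (↑P⁻¹ * Φ (s + τ) s) ^ k := by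
  induction k with
  | zero => simp [hid]
  | succ k ih =>
    have hk : (0 : ℝ) ≤ k * τ := mul_nonneg k.cast_nonneg hτ
    have step : Φ (s + ((k + 1 : ℕ) : ℝ) * τ) s
        = Φ (s + ((k + 1 : ℕ) : ℝ) * τ) (s + k * τ) * Φ (s + k * τ) s := by
      rw [hcoc]
      · linarith
      · push_cast; linarith
    have hequik : Φ (s + ((k + 1 : ℕ) : ℝ) * τ) (s + k * τ)
        = ↑(P ^ k) * Φ (s + τ) s * ↑(P ^ k)⁻¹ := by
      have h := equivariance_iterate Φ P τ hequi k (s + τ) s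
      rwa [show s + τ + (k : ℝ) * τ = s + ((k + 1 : ℕ) : ℝ) * τ by push_cast; ring] at h
    rw [step, hequik, ih, pow_succ P k, pow_succ' (↑P⁻¹ * Φ (s + τ) s) k]
    simp only [Units.val_mul, mul_assoc, Units.inv_mul_cancel_left, Units.mul_inv_cancel_left]

/-- **(F1, main) A spatio-temporal symmetry of order `m` makes the monodromy an exact `m`-th
power**: with `P ^ m = 1` and period `T = m τ`, `Φ (s + mτ) s = (P⁻¹ Φ(s+τ, s))^m` at every
phase `s`. -/
theorem monodromy_eq_pow (Φ : ℝ → ℝ → G) (P : Gˣ) {τ : ℝ} (hτ : 0 ≤ τ)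
    (hid : ∀ s : ℝ, Φ s s = 1)
    (hcoc : ∀ r u t : ℝ, r ≤ u → u ≤ t → Φ t u * Φ u r = Φ t r)
    (hequi : ∀ t s : ℝ, Φ (t + τ) (s + τ) = ↑P * Φ t s * ↑P⁻¹)
    {m : ℕ} (hP : P ^ m = 1) (s : ℝ) :
    Φ (s + m * τ) s = (↑P⁻¹ * Φ (s + τ) s) ^ m := by
  rw [propagator_add_nat_mul Φ P hτ hid hcoc hequi m s, hP, Units.val_one, one_mul]

/-- **`M₀ = K³`** (the case of record: `P` = cyclic axis permutation, `P ^ 3 = 1`, `τ = T/3` for the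
breathing ABC host `abc(1 + δ cos(Ω t + 2πj/3))`): `Φ (s + 3τ) s = (P⁻¹ Φ(s+τ, s))^3`. -/
theorem monodromy_eq_cube (Φ : ℝ → ℝ → G) (P : Gˣ) {τ : ℝ} (hτ : 0 ≤ τ)
    (hid : ∀ s : ℝ, Φ s s = 1)
    (hcoc : ∀ r u t : ℝ, r ≤ u → u ≤ t → Φ t u * Φ u r = Φ t r)
    (hequi : ∀ t s : ℝ, Φ (t + τ) (s + τ) = ↑P * Φ t s * ↑P⁻¹)
    (hP : P ^ 3 = 1) (s : ℝ) :
    Φ (s + 3 * τ) s = (↑P⁻¹ * Φ (s + τ) s) ^ 3 := by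
  simpa using monodromy_eq_pow Φ P hτ hid hcoc hequi hP s

/-- **Half-period rule** (`m = 2`, e.g. a host with `U(t + T/2) = P U(t)`, `P² = 1`):
`Φ (s + 2τ) s = (P⁻¹ Φ(s+τ, s))^2`. -/
theorem monodromy_eq_sq (Φ : ℝ → ℝ → G) (P : Gˣ) {τ : ℝ} (hτ : 0 ≤ τ)
    (hid : ∀ s : ℝ, Φ s s = 1)
    (hcoc : ∀ r u t : ℝ, r ≤ u → u ≤ t → Φ t u * Φ u r = Φ t r)
    (hequi : ∀ t s : ℝ, Φ (t + τ) (s + τ) = ↑P * Φ t s * ↑P⁻¹)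
    (hP : P ^ 2 = 1) (s : ℝ) :
    Φ (s + 2 * τ) s = (↑P⁻¹ * Φ (s + τ) s) ^ 2 := by
  simpa using monodromy_eq_pow Φ P hτ hid hcoc hequi hP s

/-- **(F2) Phase shift by one symmetry step conjugates the monodromy**: for any `T`,
`Φ (s + τ + T) (s + τ) = P Φ(s + T, s) P⁻¹` — the period readouts at `P`-cycled anchors coincide
after the shift by `τ` (the engine consistency check of record). Only equivariance is used. -/
theorem monodromy_phase_shift (Φ : ℝ → ℝ → G) (P : Gˣ) (τ T : ℝ)
    (hequi : ∀ t s : ℝ, Φ (t + τ) (s + τ) = ↑P * Φ t s * ↑P⁻¹) (s : ℝ) :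
    Φ (s + τ + T) (s + τ) = ↑P * Φ (s + T) s * ↑P⁻¹ := by
  rw [show s + τ + T = (s + T) + τ by ring, hequi]

/-- **(F2) Time-periodicity from the finite order**: `P ^ m = 1` gives
`Φ (t + mτ) (s + mτ) = Φ t s`. -/
theorem propagator_periodic (Φ : ℝ → ℝ → G) (P : Gˣ) (τ : ℝ)
    (hequi : ∀ t s : ℝ, Φ (t + τ) (s + τ) = ↑P * Φ t s * ↑P⁻¹)
    {m : ℕ} (hP : P ^ m = 1) (t s : ℝ) :
    Φ (t + m * τ) (s + m * τ) = Φ t s := by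
  rw [equivariance_iterate Φ P τ hequi m t s, hP]
  simp

/-- **(F2) Monodromies at different phases are intertwined by the propagator**:
`M_s Φ(s,0) = Φ(s,0) M_0` for `0 ≤ s`, where `M_s = Φ (s + mτ) s` (so wherever `Φ(s,0)` is
invertible they are conjugate and carry the same multipliers). -/
theorem monodromy_intertwine (Φ : ℝ → ℝ → G) (P : Gˣ) {τ : ℝ} (hτ : 0 ≤ τ)
    (hcoc : ∀ r u t : ℝ, r ≤ u → u ≤ t → Φ t u * Φ u r = Φ t r)
    (hequi : ∀ t s : ℝ, Φ (t + τ) (s + τ) = ↑P * Φ t s * ↑P⁻¹)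
    {m : ℕ} (hP : P ^ m = 1) {s : ℝ} (hs : 0 ≤ s) :
    Φ (s + m * τ) s * Φ s 0 = Φ s 0 * Φ (0 + m * τ) 0 := by
  have hT : (0 : ℝ) ≤ m * τ := mul_nonneg m.cast_nonneg hτ
  have hper : Φ (s + m * τ) (0 + m * τ) = Φ s 0 := propagator_periodic Φ P τ hequi hP s 0
  rw [hcoc 0 s (s + m * τ) hs (by linarith), ← hper,
    hcoc 0 (0 + m * τ) (s + m * τ) (by linarith) (by linarith)]

end Propagator

/-! ## Spectral consequence in an endomorphism monoid -/

section Spectral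

variable {R : Type*} [CommRing R] {V : Type*} [AddCommGroup V] [Module R V]

/-- If `K v = κ v` then `K^m v = κ^m v`: an eigenvector of the symmetry-step operator `K` is a
Floquet mode of `M = K ^ m` with multiplier `κ ^ m` (converse for SIMPLE multipliers, `m = 3`:
`FloquetCubeRootClass.exists_cube_root_of_simple`). -/
theorem pow_apply_of_eigen (K : Module.End R V) {κ : R} {v : V} (hK : K v = κ • v) (m : ℕ) :
    (K ^ m) v = κ ^ m • v := by
  induction m with
  | zero => simp
  | succ m ih => rw [pow_succ', Module.End.mul_apply, ih, map_smul, hK, smul_smul, ← pow_succ]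

end Spectral

/-! ## (F3) Locking rule: when is a cube real, and of which sign -/

section Locking

/- The component formulas `Im (κ³) = Im κ·(3Re²κ − Im²κ)`, `Re (κ³) = Re κ·(Re²κ − 3Im²κ)` are
already in the tree (`Literature.Geometry.Lorentzian.WeylPhase.im_cube / re_cube`, folklore); they
are reused, not restated. -/
open Literature.Geometry.Lorentzian.WeylPhase (im_cube re_cube)

/-- A cube is real iff `κ` is real or lies on one of the directions `Im²κ = 3 Re²κ`
(`arg κ ∈ {±π/3, ±2π/3}`). -/
theorem im_cube_eq_zero_iff (z : ℂ) :
    (z ^ 3).im = 0 ↔ z.im = 0 ∨ z.im ^ 2 = 3 * z.re ^ 2 := by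
  rw [im_cube, mul_eq_zero]
  constructor
  · rintro (h | h)
    · exact Or.inl h
    · exact Or.inr (by linarith)
  · rintro (h | h)
    · exact Or.inl h
    · exact Or.inr (by linarith)

/-- On the locking directions `Im²κ = 3 Re²κ` the cube is `−8 Re³κ`: its sign is OPPOSITE to the
sign of `Re κ` (directions `±π/3` lock onto the negative real axis, `±2π/3` onto the positive). -/
theorem pow_three_of_locked {z : ℂ} (h : z.im ^ 2 = 3 * z.re ^ 2) :
    z ^ 3 = ((-8 * z.re ^ 3 : ℝ) : ℂ) := by
  apply Complex.ext
  · rw [re_cube, Complex.ofReal_re, h]; ring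
  · rw [im_cube, Complex.ofReal_im, h]; ring

/-- Real part of the cube on a locking direction. -/
theorem re_cube_of_locked {z : ℂ} (h : z.im ^ 2 = 3 * z.re ^ 2) :
    (z ^ 3).re = -8 * z.re ^ 3 := by
  rw [pow_three_of_locked h]; norm_cast

/-- **Locking rule, complete form.** `κ³` is a POSITIVE REAL number iff either `κ` is a positive
real, or `κ` is non-real on a direction `±2π/3` (`Im²κ = 3Re²κ`, `Re κ < 0`). -/
theorem cube_real_pos_iff (z : ℂ) :
    ((z ^ 3).im = 0 ∧ 0 < (z ^ 3).re) ↔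
      (z.im = 0 ∧ 0 < z.re) ∨ (z.im ^ 2 = 3 * z.re ^ 2 ∧ z.re < 0) := by
  constructor
  · rintro ⟨him, hre⟩
    rcases (im_cube_eq_zero_iff z).mp him with h | h
    · left
      refine ⟨h, ?_⟩
      rw [re_cube, h] at hre
      have : 0 < z.re * z.re ^ 2 := by nlinarith [hre]
      nlinarith [sq_nonneg z.re, this]
    · right
      refine ⟨h, ?_⟩
      rw [re_cube_of_locked h] at hre
      nlinarith [sq_nonneg z.re, hre]
  · rintro (⟨him, hre⟩ | ⟨h, hre⟩)
    · refine ⟨by rw [im_cube, him]; ring, ?_⟩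
      rw [re_cube, him]
      nlinarith [pow_pos hre 3]
    · refine ⟨(im_cube_eq_zero_iff z).mpr (Or.inr h), ?_⟩
      rw [re_cube_of_locked h]
      have : z.re ^ 3 < 0 := by
        have := Odd.pow_neg (show Odd 3 by decide) hre
        exact this
      linarith

/-- **Locking rule, negative axis.** `κ³` is a NEGATIVE REAL number iff either `κ` is a negative
real, or `κ` is non-real on a direction `±π/3` (`Im²κ = 3Re²κ`, `Re κ > 0`). -/
theorem cube_real_neg_iff (z : ℂ) :
    ((z ^ 3).im = 0 ∧ (z ^ 3).re < 0) ↔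
      (z.im = 0 ∧ z.re < 0) ∨ (z.im ^ 2 = 3 * z.re ^ 2 ∧ 0 < z.re) := by
  have h := cube_real_pos_iff (-z)
  have e3 : (-z) ^ 3 = -(z ^ 3) := by ring
  simp only [e3, Complex.neg_im, Complex.neg_re, neg_eq_zero, neg_pos, neg_lt_zero, even_two,
    Even.neg_pow] at h
  exact h

end Locking

/-! ## (F4) Doublet determinant rule on an invariant 2-plane -/

section Doublet

open Matrix

/-- **Cayley–Hamilton for 2×2 blocks**: `A² − (tr A) A + (det A) 1 = 0`. -/
theorem cayley_hamilton_fin_two {S : Type*} [CommRing S] (A : Matrix (Fin 2) (Fin 2) S) :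
    A * A - (Matrix.trace A) • A + (Matrix.det A) • (1 : Matrix (Fin 2) (Fin 2) S) = 0 := by
  ext i j
  fin_cases i <;> fin_cases j <;>
    simp [Matrix.mul_apply, Fin.sum_univ_two, Matrix.det_fin_two, Matrix.trace_fin_two] <;> ring

/-- **Eigenvalues of a 2×2 block are roots of `z² − t z + d`** (`t` = trace, `d` = determinant):
if `A v = κ v` with `v ≠ 0` over a field, then `κ² − t κ + d = 0`. -/
theorem quadratic_of_eigen_fin_two {F : Type*} [Field F] (A : Matrix (Fin 2) (Fin 2) F)
    {κ : F} {v : Fin 2 → F} (hv : v ≠ 0) (hA : A.mulVec v = κ • v) :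
    κ ^ 2 - Matrix.trace A * κ + Matrix.det A = 0 := by
  have hCH := cayley_hamilton_fin_two A
  have h2 : (A * A).mulVec v = (κ ^ 2) • v := by
    rw [← Matrix.mulVec_mulVec, hA, Matrix.mulVec_smul, hA, smul_smul, pow_two]
  have hv' : (κ ^ 2 - Matrix.trace A * κ + Matrix.det A) • v = 0 := by
    have := congrArg (fun B : Matrix (Fin 2) (Fin 2) F => B.mulVec v) hCH
    simp only [Matrix.add_mulVec, Matrix.sub_mulVec, Matrix.smul_mulVec, Matrix.one_mulVec,
      Matrix.zero_mulVec, h2, hA, smul_smul] at this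
    rw [← this, add_smul, sub_smul]
  rcases smul_eq_zero.mp hv' with h | h
  · exact h
  · exact absurd h hv

/-- **A non-real root of a real quadratic `z² − t z + d` has `|z|² = d` and `2 Re z = t`.** -/
theorem normSq_eq_of_nonreal_root {t d : ℝ} {z : ℂ}
    (hz : z ^ 2 - (t : ℂ) * z + (d : ℂ) = 0) (hnr : z.im ≠ 0) :
    Complex.normSq z = d ∧ 2 * z.re = t := by
  have hre := congrArg Complex.re hz
  have him := congrArg Complex.im hz
  simp only [Complex.sub_re, Complex.add_re, Complex.sub_im, Complex.add_im, Complex.mul_re,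
    Complex.mul_im, Complex.ofReal_re, Complex.ofReal_im, zero_mul, sub_zero, add_zero,
    Complex.zero_re, Complex.zero_im, pow_two] at hre him
  have ht : 2 * z.re = t := by
    have : z.im * (2 * z.re - t) = 0 := by linear_combination him
    rcases mul_eq_zero.mp this with h | h
    · exact absurd h hnr
    · linarith
  refine ⟨?_, ht⟩
  have h3 : t * z.re = 2 * (z.re * z.re) := by rw [← ht]; ring
  rw [Complex.normSq_apply]
  linarith [hre, h3]

/-- **Two distinct real roots of `r² − t r + d` have product `d` and sum `t`** (Vieta). -/
theorem vieta_of_real_roots {t d r₁ r₂ : ℝ}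
    (h₁ : r₁ ^ 2 - t * r₁ + d = 0) (h₂ : r₂ ^ 2 - t * r₂ + d = 0) (hne : r₁ ≠ r₂) :
    r₁ * r₂ = d ∧ r₁ + r₂ = t := by
  have hsum : r₁ + r₂ = t := by
    have : (r₁ - r₂) * (r₁ + r₂ - t) = 0 := by linear_combination h₁ - h₂
    rcases mul_eq_zero.mp this with h | h
    · exact absurd (sub_eq_zero.mp h) hne
    · linarith
  refine ⟨?_, hsum⟩
  have : r₂ = t - r₁ := by linarith
  subst this
  nlinarith [h₁]

/-- **Doublet sum rule (real side).** Two distinct real roots `κ₊, κ₋` of `r² − t r + d` with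
`d > 0` satisfy `log|κ₊| + log|κ₋| = log d`: the SUM of the two real Floquet exponents
(`γ± = log|κ±|/τ`) is fixed by the determinant of the block alone. -/
theorem log_sum_eq_of_real_roots {t d r₁ r₂ : ℝ} (hd : 0 < d)
    (h₁ : r₁ ^ 2 - t * r₁ + d = 0) (h₂ : r₂ ^ 2 - t * r₂ + d = 0) (hne : r₁ ≠ r₂) :
    Real.log |r₁| + Real.log |r₂| = Real.log d := by
  obtain ⟨hprod, -⟩ := vieta_of_real_roots h₁ h₂ hne
  have h1 : r₁ ≠ 0 := by rintro rfl; simp at hprod; linarith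
  have h2 : r₂ ≠ 0 := by rintro rfl; simp at hprod; linarith
  rw [← Real.log_mul (abs_ne_zero.mpr h1) (abs_ne_zero.mpr h2), ← abs_mul, hprod, abs_of_pos hd]

/-- **Doublet sum rule (complex side).** A non-real root `z` of `z² − t z + d` has
`2 log ‖z‖ = log d`: the common Floquet exponent of the complex pair (`γ = log‖z‖/τ`) is again
fixed by the determinant alone — so at a collision parameter (fixed `t, d`, discriminant zero up
to sign) `γ₊ + γ₋ = 2 γ_pair` exactly. -/
theorem two_log_norm_eq_of_nonreal_root {t d : ℝ} {z : ℂ}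
    (hz : z ^ 2 - (t : ℂ) * z + (d : ℂ) = 0) (hnr : z.im ≠ 0) :
    2 * Real.log ‖z‖ = Real.log d := by
  obtain ⟨hn, -⟩ := normSq_eq_of_nonreal_root hz hnr
  rw [← hn, ← Complex.sq_norm, Real.log_pow]
  norm_num

end Doublet

end Summit.NavierStokesRegularity.FluidComputer.SpatioTemporalMonodromyFactorisation
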